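import Summits.QuantumFields.YangMills.Theorems.IR.BlockedActivityWStrongCouplingMeshPrep
import HarnessLib

/-!
# Crux `IR` (stmt-QuantumFields-19354), lane B «strong coupling AFTER BLOCKING»: frame REFINEMENT — every mesh-`K·b` frame splits into a
# mesh-`b` frame, `K` pieces per coarse interval (geometry only; part 1 of «TV ⇒ W», no measure theory)

Helper module for item `stmt-QuantumFields-19354` (`--supports`; it closes nothing), lane `ym-19354-onsetsc-p2` (g6).  Preparations for
`Theorems/IR/BlockedActivityWOfMixing` («the class of record at mesh `K·b` from the universal shell condition (total-variation mixing of the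
crux format) at mesh `b`»), where the Dobrushin–Shlosman bootstrap of the tree (`FiniteSizeCriterion.recursion_decay`, shape-blind) and the
chain rule `FiniteSizeCriterion.multiCell_influence_general` run on the FINE cells of a refinement of the coarse frame whose class is certified.

* §1 `refineFrame K b w` — the refinement of a frame `w` with interval lengths in `[K·b, 2K·b]` into `K` consecutive pieces per interval, each of
  length in `[b, 2b]` (greedy fill: `refineFrame K b w i (Kq + r) = min (w i (q+1) − (K − r)·b) (w i q + 2r·b)`); `refineFrame_mul`
  (the coarse breakpoints are fine breakpoints: index `K·q`), `isFrame_refineFrame` (mesh `b`), `le_refineFrame` ∕ `refineFrame_succ_le`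
  (a fine interval sits inside its coarse interval).
* §2 cells: `cellEdges_refineFrame_subset` (the fine cell `m` lies in the coarse cell `(mᵢ ∕ K)ᵢ`), `frameCell_eq_ediv_frameCell_refineFrame`
  (the coarse cell of a link is the integer quotient of its fine cell), `coarse_frameCell_eq_of_fine` (links in one fine cell lie in one coarse
  cell), hence every coarse cell union — a region `regionEdges w Y`, the inner volume `innerEdges w Y` — is a union of fine cells
  (`regionEdges_union_refine`, `innerEdges_union_refine`).
* §3 distances on a mesh-`b` frame `u` (`b ≥ 1`): `frame_le_add_mul_two` (`u i (j + m) ≤ u i j + 2b·m`), `abs_sub_le_of_near_cells` (links in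
  cells at index sup-distance `≤ N` have base points at sup-distance `< 2b(N+1)`), `norm_sub_le_of_near_cells`, and the form consumed by
  `blockedActivityClassW_of_influence` at the coarse mesh `(N+2)·b`, window `1`: `floor_norm_le_of_near_plaqNbhd` — a link whose cell is within
  index distance `N` of the cell of a link of the plaquette neighbourhood of `a` has `⌊‖z − a‖⌋ ≤ 2·1·((N+2)·b)`.

HONEST FRAMING: bookkeeping; nothing about mixing, a gap or Clay.  No `sorry`; axioms ⊆ {propext, Classical.choice, Quot.sound}; no instances,
no notation.
-/

set_option autoImplicit false

noncomputable section

open Literature.MathematicalPhysics.QuantumLattice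
open Summit.QuantumFields.YangMills.Cruxes.IR.Tempered (cellEdges windowCells regionEdges collarEdges)
open Summit.QuantumFields.YangMills.Cruxes.IR.CellTempered.Engine (frameCell frameCell_eq_iff mem_cellEdges_frameCell frame_hC1
  regionEdges_union)

namespace Summit.QuantumFields.YangMills.Cruxes.IR.BlockedActivity

/-! ## §1 The refinement of a mesh-`K·b` frame into a mesh-`b` frame -/

section Refine

variable {K b : ℕ} {w : Fin 4 → ℤ → ℤ}

/-- **The refinement** of the frame `w` (interval lengths in `[K·b, 2K·b]`) into `K` pieces per interval: for the fine index `m = K·q + r`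
(`0 ≤ r < K`) the fine breakpoint is `min (w i (q+1) − (K − r)·b) (w i q + 2r·b)` — the first pieces have length `2b` until the surplus
`w i (q+1) − w i q − K·b` is used up, the remaining ones length `b`. -/
def refineFrame (K b : ℕ) (w : Fin 4 → ℤ → ℤ) : Fin 4 → ℤ → ℤ := fun i m =>
  min (w i (m / (K : ℤ) + 1) - ((K : ℤ) - m % (K : ℤ)) * (b : ℤ)) (w i (m / (K : ℤ)) + 2 * (m % (K : ℤ)) * (b : ℤ))

/-- The mesh bound of a mesh-`K·b` frame with the product cast split. -/
theorem isFrame_mul_iff : AfPincerUc.IsFrame (K * b) w ↔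
    ∀ i j, w i j + (K : ℤ) * (b : ℤ) ≤ w i (j + 1) ∧ w i (j + 1) ≤ w i j + 2 * ((K : ℤ) * (b : ℤ)) := by
  unfold AfPincerUc.IsFrame
  push_cast
  exact Iff.rfl

/-- **The coarse breakpoints are fine breakpoints**: `refineFrame K b w i (K·q) = w i q` (`K ≥ 1`). -/
theorem refineFrame_mul (hK : 1 ≤ K) (hw : AfPincerUc.IsFrame (K * b) w) (i : Fin 4) (q : ℤ) :
    refineFrame K b w i ((K : ℤ) * q) = w i q := by
  have hK0 : (K : ℤ) ≠ 0 := by exact_mod_cast (Nat.one_le_iff_ne_zero.1 hK)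
  have h1 : (K : ℤ) * q / (K : ℤ) = q := Int.mul_ediv_cancel_left q hK0
  have h2 : (K : ℤ) * q % (K : ℤ) = 0 := Int.mul_emod_right _ _
  have hwq := (isFrame_mul_iff.1 hw i q).1
  simp only [refineFrame, h1, h2, sub_zero, mul_zero, zero_mul, add_zero]
  exact min_eq_right (by linarith)

/-- Euclidean decomposition of a fine index: `m = K·(m∕K) + m % K`, `0 ≤ m % K < K`. -/
theorem fine_index_decomp (hK : 1 ≤ K) (m : ℤ) :
    m % (K : ℤ) + (K : ℤ) * (m / (K : ℤ)) = m ∧ 0 ≤ m % (K : ℤ) ∧ m % (K : ℤ) < (K : ℤ) := by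
  have hKpos : (0 : ℤ) < (K : ℤ) := by exact_mod_cast hK
  refine ⟨?_, Int.emod_nonneg m hKpos.ne', Int.emod_lt_of_pos m hKpos⟩
  have h := Int.emod_add_ediv_mul m (K : ℤ)
  linarith [mul_comm (m / (K : ℤ)) (K : ℤ)]

/-- The successor of a fine index inside a coarse interval: if `m % K + 1 < K` then `(m+1)∕K = m∕K` and `(m+1) % K = m % K + 1`. -/
theorem fine_index_succ_of_lt (hK : 1 ≤ K) {m : ℤ} (h : m % (K : ℤ) + 1 < (K : ℤ)) :
    (m + 1) / (K : ℤ) = m / (K : ℤ) ∧ (m + 1) % (K : ℤ) = m % (K : ℤ) + 1 := by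
  have hKpos : (0 : ℤ) < (K : ℤ) := by exact_mod_cast hK
  obtain ⟨hm, hr0, -⟩ := fine_index_decomp hK m
  exact (Int.ediv_emod_unique hKpos).2 ⟨by linarith, by linarith, h⟩

/-- The successor of the last fine index of a coarse interval: if `m % K + 1 = K` then `(m+1)∕K = m∕K + 1` and `(m+1) % K = 0`. -/
theorem fine_index_succ_of_eq (hK : 1 ≤ K) {m : ℤ} (h : m % (K : ℤ) + 1 = (K : ℤ)) :
    (m + 1) / (K : ℤ) = m / (K : ℤ) + 1 ∧ (m + 1) % (K : ℤ) = 0 := by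
  have hKpos : (0 : ℤ) < (K : ℤ) := by exact_mod_cast hK
  obtain ⟨hm, -, -⟩ := fine_index_decomp hK m
  exact (Int.ediv_emod_unique hKpos).2 ⟨by linarith, le_rfl, hKpos⟩

/-- Elementary: `b ≤ min (X + b) (Y + 2b) − min X Y ≤ 2b` for `b ≥ 0`. -/
theorem min_step_bounds {X Y c : ℤ} (hc : 0 ≤ c) :
    c ≤ min (X + c) (Y + 2 * c) - min X Y ∧ min (X + c) (Y + 2 * c) - min X Y ≤ 2 * c := by
  rcases le_total X Y with h | h <;> rcases le_total (X + c) (Y + 2 * c) with h' | h'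
  · rw [min_eq_left h, min_eq_left h']; constructor <;> linarith
  · rw [min_eq_left h, min_eq_right h']; constructor <;> linarith
  · rw [min_eq_right h, min_eq_left h']; constructor <;> linarith
  · rw [min_eq_right h, min_eq_right h']; constructor <;> linarith

/-- **The refinement is a mesh-`b` frame** (`K ≥ 1`): consecutive fine breakpoints differ by an amount in `[b, 2b]`. -/
theorem isFrame_refineFrame (hK : 1 ≤ K) (hw : AfPincerUc.IsFrame (K * b) w) : AfPincerUc.IsFrame b (refineFrame K b w) := by
  intro i m
  have hKpos : (0 : ℤ) < (K : ℤ) := by exact_mod_cast hK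
  have hb0 : (0 : ℤ) ≤ (b : ℤ) := by positivity
  obtain ⟨hm, hr0, hrK⟩ := fine_index_decomp hK m
  set q : ℤ := m / (K : ℤ) with hq
  set r : ℤ := m % (K : ℤ) with hr
  have hwq := isFrame_mul_iff.1 hw i q
  have hwq1 := isFrame_mul_iff.1 hw i (q + 1)
  by_cases hlast : r + 1 < (K : ℤ)
  · -- inside the coarse interval
    obtain ⟨hq', hr'⟩ := fine_index_succ_of_lt hK (m := m) hlast
    have e1 : w i (q + 1) - ((K : ℤ) - (r + 1)) * (b : ℤ) = (w i (q + 1) - ((K : ℤ) - r) * (b : ℤ)) + (b : ℤ) := by ring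
    have e2 : w i q + 2 * (r + 1) * (b : ℤ) = (w i q + 2 * r * (b : ℤ)) + 2 * (b : ℤ) := by ring
    have hstep := min_step_bounds (X := w i (q + 1) - ((K : ℤ) - r) * (b : ℤ)) (Y := w i q + 2 * r * (b : ℤ)) hb0
    simp only [refineFrame]
    rw [hq', hr', ← hq, ← hr, e1, e2]
    constructor <;> linarith [hstep.1, hstep.2]
  · -- the last piece of the coarse interval
    have hrK' : r + 1 = (K : ℤ) := le_antisymm (by linarith) (not_lt.1 hlast)
    obtain ⟨hq', hr'⟩ := fine_index_succ_of_eq hK (m := m) hrK'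
    have hKr : (K : ℤ) - r = 1 := by linarith
    simp only [refineFrame]
    rw [hq', hr', ← hq, ← hr, hKr, sub_zero, mul_zero, zero_mul, add_zero, one_mul]
    rw [min_eq_right (by linarith : w i (q + 1) ≤ w i (q + 1 + 1) - (K : ℤ) * (b : ℤ))]
    have h2r : 2 * r * (b : ℤ) = 2 * ((K : ℤ) * (b : ℤ)) - 2 * (b : ℤ) := by
      rw [← hrK']; ring
    rw [h2r]
    rcases le_total (w i (q + 1) - (b : ℤ)) (w i q + (2 * ((K : ℤ) * (b : ℤ)) - 2 * (b : ℤ))) with h | h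
    · rw [min_eq_left h]; constructor <;> linarith
    · rw [min_eq_right h]; constructor <;> linarith

/-- **A fine breakpoint is at or after its coarse breakpoint**: `w i (m ∕ K) ≤ refineFrame K b w i m`. -/
theorem le_refineFrame (hK : 1 ≤ K) (hw : AfPincerUc.IsFrame (K * b) w) (i : Fin 4) (m : ℤ) :
    w i (m / (K : ℤ)) ≤ refineFrame K b w i m := by
  have hb0 : (0 : ℤ) ≤ (b : ℤ) := by positivity
  obtain ⟨-, hr0, hrK⟩ := fine_index_decomp hK m
  have hwq := isFrame_mul_iff.1 hw i (m / (K : ℤ))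
  simp only [refineFrame]
  refine le_min ?_ ?_
  · have h1 : ((K : ℤ) - m % (K : ℤ)) * (b : ℤ) ≤ (K : ℤ) * (b : ℤ) := by nlinarith
    linarith
  · nlinarith

/-- **The next fine breakpoint is at or before the next coarse breakpoint**: `refineFrame K b w i (m + 1) ≤ w i (m ∕ K + 1)`. -/
theorem refineFrame_succ_le (hK : 1 ≤ K) (hw : AfPincerUc.IsFrame (K * b) w) (i : Fin 4) (m : ℤ) :
    refineFrame K b w i (m + 1) ≤ w i (m / (K : ℤ) + 1) := by
  have hb0 : (0 : ℤ) ≤ (b : ℤ) := by positivity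
  obtain ⟨hm, hr0, hrK⟩ := fine_index_decomp hK m
  by_cases hlast : m % (K : ℤ) + 1 < (K : ℤ)
  · obtain ⟨hq', hr'⟩ := fine_index_succ_of_lt hK (m := m) hlast
    simp only [refineFrame]
    rw [hq', hr']
    refine (min_le_left _ _).trans ?_
    have h1 : 0 ≤ ((K : ℤ) - (m % (K : ℤ) + 1)) * (b : ℤ) := by nlinarith
    linarith
  · have hrK' : m % (K : ℤ) + 1 = (K : ℤ) := le_antisymm (by linarith) (not_lt.1 hlast)
    obtain ⟨hq', hr'⟩ := fine_index_succ_of_eq hK (m := m) hrK'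
    have hmul : m + 1 = (K : ℤ) * (m / (K : ℤ) + 1) := by linarith
    rw [hmul, refineFrame_mul hK hw]

end Refine

/-! ## §2 Cells: a fine cell lies in one coarse cell; coarse cell unions are fine cell unions -/

section Cells

variable {K b : ℕ} {w : Fin 4 → ℤ → ℤ}

/-- **The fine cell `m` lies in the coarse cell `(mᵢ ∕ K)ᵢ`.** -/
theorem cellEdges_refineFrame_subset (hK : 1 ≤ K) (hw : AfPincerUc.IsFrame (K * b) w) (m : Cell) :
    cellEdges (refineFrame K b w) m ⊆ cellEdges w (fun i => m i / (K : ℤ)) := by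
  intro v hv
  simp only [Summit.QuantumFields.YangMills.Cruxes.IR.Tempered.cellEdges, Finset.mem_product, Finset.mem_univ, and_true,
    Fintype.mem_piFinset, Finset.mem_Ico] at hv ⊢
  intro i
  obtain ⟨h1, h2⟩ := hv i
  exact ⟨(le_refineFrame hK hw i (m i)).trans h1, h2.trans_le (refineFrame_succ_le hK hw i (m i))⟩

/-- A mesh-`b` frame with `b ≥ 1` is strictly increasing by at least `1` per step. -/
theorem frame_one_of_isFrame (hb : 1 ≤ b) {u : Fin 4 → ℤ → ℤ} (hu : AfPincerUc.IsFrame b u) : ∀ i j, u i j + 1 ≤ u i (j + 1) :=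
  frame_step hu hb

/-- **The coarse cell of a link is the integer quotient of its fine cell** (`K, b ≥ 1`). -/
theorem frameCell_eq_ediv_frameCell_refineFrame (hK : 1 ≤ K) (hb : 1 ≤ b) (hw : AfPincerUc.IsFrame (K * b) w) (v : ZdEdge 4) :
    frameCell w v = fun i => frameCell (refineFrame K b w) v i / (K : ℤ) := by
  have hKb : 1 ≤ K * b := Nat.one_le_iff_ne_zero.2 (Nat.mul_ne_zero (by omega) (by omega))
  have hw1 := frame_one_of_isFrame hKb hw
  have hf1 := frame_one_of_isFrame hb (isFrame_refineFrame hK hw)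
  exact (frameCell_eq_iff hw1 v _).2 (cellEdges_refineFrame_subset hK hw _ (mem_cellEdges_frameCell hf1 v))

/-- **Links in one fine cell lie in one coarse cell.** -/
theorem coarse_frameCell_eq_of_fine (hK : 1 ≤ K) (hb : 1 ≤ b) (hw : AfPincerUc.IsFrame (K * b) w) {v v' : ZdEdge 4}
    (h : frameCell (refineFrame K b w) v = frameCell (refineFrame K b w) v') : frameCell w v = frameCell w v' := by
  rw [frameCell_eq_ediv_frameCell_refineFrame hK hb hw v, frameCell_eq_ediv_frameCell_refineFrame hK hb hw v', h]

/-- **A coarse region is a union of fine cells.** -/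
theorem regionEdges_union_refine (hK : 1 ≤ K) (hb : 1 ≤ b) (hw : AfPincerUc.IsFrame (K * b) w) (Y : Finset Cell) (v v' : ZdEdge 4)
    (h : frameCell (refineFrame K b w) v = frameCell (refineFrame K b w) v') (hv : v ∈ regionEdges w Y) : v' ∈ regionEdges w Y := by
  have hKb : 1 ≤ K * b := Nat.one_le_iff_ne_zero.2 (Nat.mul_ne_zero (by omega) (by omega))
  exact regionEdges_union (frame_one_of_isFrame hKb hw) Y v v' (coarse_frameCell_eq_of_fine hK hb hw h) hv

/-- **A coarse cell is a union of fine cells.** -/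
theorem cellEdges_union_refine (hK : 1 ≤ K) (hb : 1 ≤ b) (hw : AfPincerUc.IsFrame (K * b) w) (c : Cell) (v v' : ZdEdge 4)
    (h : frameCell (refineFrame K b w) v = frameCell (refineFrame K b w) v') (hv : v ∈ cellEdges w c) : v' ∈ cellEdges w c := by
  have hKb : 1 ≤ K * b := Nat.one_le_iff_ne_zero.2 (Nat.mul_ne_zero (by omega) (by omega))
  have hw1 := frame_one_of_isFrame hKb hw
  rw [← frameCell_eq_iff hw1] at hv ⊢
  rw [← coarse_frameCell_eq_of_fine hK hb hw h, hv]

/-- **The inner volume of a coarse region is a union of fine cells.** -/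
theorem innerEdges_union_refine (hK : 1 ≤ K) (hb : 1 ≤ b) (hw : AfPincerUc.IsFrame (K * b) w) (Y : Finset Cell) (v v' : ZdEdge 4)
    (h : frameCell (refineFrame K b w) v = frameCell (refineFrame K b w) v') (hv : v ∈ innerEdges w Y) : v' ∈ innerEdges w Y := by
  simp only [innerEdges, Finset.mem_sdiff] at hv ⊢
  exact ⟨regionEdges_union_refine hK hb hw Y v v' h hv.1, fun hv' => hv.2 (cellEdges_union_refine hK hb hw 0 v' v h.symm hv')⟩

end Cells

/-! ## §3 Distances on a mesh-`b` frame -/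

section Distances

variable {b : ℕ} {u : Fin 4 → ℤ → ℤ}

/-- A mesh-`b` frame gains at most `2b·m` in `m` steps. -/
theorem frame_le_add_mul_two (hu : AfPincerUc.IsFrame b u) (i : Fin 4) (j : ℤ) (m : ℕ) :
    u i (j + m) ≤ u i j + (m : ℤ) * (2 * ((b : ℕ) : ℤ)) := by
  induction m with
  | zero => simp
  | succ m ih =>
    have h1 := (hu i (j + m)).2
    have e1 : (j + ((m + 1 : ℕ) : ℤ)) = j + (m : ℤ) + 1 := by push_cast; ring
    have e2 : (((m + 1 : ℕ) : ℤ)) * (2 * ((b : ℕ) : ℤ)) = (m : ℤ) * (2 * ((b : ℕ) : ℤ)) + 2 * ((b : ℕ) : ℤ) := by push_cast; ring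
    rw [e1, e2]
    linarith

/-- **Links in cells at index sup-distance `≤ N` have base points at sup-distance `< 2b(N+1)`** (coordinatewise). -/
theorem abs_sub_le_of_near_cells (hu : AfPincerUc.IsFrame b u) (hb : 1 ≤ b) {v e : ZdEdge 4} {N : ℕ}
    (h : ∀ i, |frameCell u v i - frameCell u e i| ≤ N) (i : Fin 4) :
    |v.1 i - e.1 i| ≤ 2 * ((b : ℕ) : ℤ) * ((N : ℤ) + 1) - 1 := by
  have hu1 := frame_step hu hb
  have hv := mem_cellEdges_frameCell hu1 v
  have he := mem_cellEdges_frameCell hu1 e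
  simp only [Summit.QuantumFields.YangMills.Cruxes.IR.Tempered.cellEdges, Finset.mem_product, Finset.mem_univ, and_true,
    Fintype.mem_piFinset, Finset.mem_Ico] at hv he
  obtain ⟨hv1, hv2⟩ := hv i
  obtain ⟨he1, he2⟩ := he i
  have hN := abs_le.1 (h i)
  have hcast : (((N + 1 : ℕ) : ℤ)) = (N : ℤ) + 1 := by push_cast; ring
  -- upper: `v.1 i < u i (cv + 1) ≤ u i (ce + (N + 1)) ≤ u i ce + (N+1)·2b ≤ e.1 i + 2b(N+1)`
  have hup1 : u i (frameCell u v i + 1) ≤ u i (frameCell u e i + ((N + 1 : ℕ) : ℤ)) :=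
    frame_mono hu i (by rw [hcast]; linarith [hN.2])
  have hup2 := frame_le_add_mul_two hu i (frameCell u e i) (N + 1)
  -- lower: `u i (ce - N) ≤ u i cv ≤ v.1 i` and `u i (ce + 1) = u i ((ce - N) + (N + 1)) ≤ u i (ce - N) + (N+1)·2b`
  have hlo1 : u i (frameCell u e i - (N : ℤ)) ≤ u i (frameCell u v i) := frame_mono hu i (by linarith [hN.1])
  have hlo2 := frame_le_add_mul_two hu i (frameCell u e i - (N : ℤ)) (N + 1)
  have e3 : frameCell u e i - (N : ℤ) + ((N + 1 : ℕ) : ℤ) = frameCell u e i + 1 := by rw [hcast]; ring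
  rw [e3] at hlo2
  have hprod : (((N + 1 : ℕ) : ℤ)) * (2 * ((b : ℕ) : ℤ)) = 2 * ((b : ℕ) : ℤ) * ((N : ℤ) + 1) := by rw [hcast]; ring
  rw [hprod] at hup2 hlo2
  rw [abs_le]
  constructor <;> linarith

/-- **Sup-norm form**: `‖v − e‖ ≤ 2b(N+1) − 1`. -/
theorem norm_sub_le_of_near_cells (hu : AfPincerUc.IsFrame b u) (hb : 1 ≤ b) {v e : ZdEdge 4} {N : ℕ}
    (h : ∀ i, |frameCell u v i - frameCell u e i| ≤ N) :
    ‖v.1 - e.1‖ ≤ (2 * (b : ℝ) * ((N : ℝ) + 1) - 1) := by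
  have hnn : (0 : ℝ) ≤ 2 * (b : ℝ) * ((N : ℝ) + 1) - 1 := by
    have : (1 : ℝ) ≤ b := by exact_mod_cast hb
    nlinarith
  refine (pi_norm_le_iff_of_nonneg hnn).2 fun i => ?_
  rw [Pi.sub_apply, Int.norm_eq_abs, Int.cast_sub]
  have h1 := abs_sub_le_of_near_cells hu hb h i
  have h2 : ((|v.1 i - e.1 i| : ℤ) : ℝ) ≤ ((2 * ((b : ℕ) : ℤ) * ((N : ℤ) + 1) - 1 : ℤ) : ℝ) := by exact_mod_cast h1
  push_cast at h2
  exact h2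

/-- **The agreement radius of `blockedActivityClassW_of_influence` at the coarse mesh `(N+2)·b`, window `1`**: a link `z` whose cell (mesh-`b`
frame `u`, `b ≥ 1`) is within index sup-distance `N` of the cell of a link `e` of the plaquette neighbourhood of `a` satisfies
`⌊‖z − a‖⌋ ≤ 2·1·((N+2)·b)`. -/
theorem floor_norm_le_of_near_plaqNbhd (hu : AfPincerUc.IsFrame b u) (hb : 1 ≤ b) {a e z : ZdEdge 4} {N : ℕ}
    (he : e ∈ (plaquettesTouching ({a} : Finset (ZdEdge 4))).biUnion plaquetteEdges)
    (h : ∀ i, |frameCell u z i - frameCell u e i| ≤ N) : ⌊‖z.1 - a.1‖⌋₊ ≤ 2 * 1 * ((N + 2) * b) := by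
  obtain ⟨p, hp, hep⟩ := Finset.mem_biUnion.1 he
  have hap : a ∈ plaquetteEdges p := Literature.MathematicalPhysics.QuantumFieldTheory.mem_plaquettesTouching_singleton.1 hp
  have h1 : ‖e.1 - a.1‖ ≤ (1 : ℝ) := Literature.MathematicalPhysics.QuantumFieldTheory.norm_sub_le_one_of_mem_plaquetteEdges hep hap
  have h2 := norm_sub_le_of_near_cells hu hb h
  have h3 : ‖z.1 - a.1‖ ≤ ((2 * 1 * ((N + 2) * b) : ℕ) : ℝ) := by
    have htri : ‖z.1 - a.1‖ ≤ ‖z.1 - e.1‖ + ‖e.1 - a.1‖ := norm_sub_le_norm_sub_add_norm_sub _ _ _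
    have hb1 : (1 : ℝ) ≤ b := by exact_mod_cast hb
    push_cast
    nlinarith
  calc ⌊‖z.1 - a.1‖⌋₊ ≤ ⌊((2 * 1 * ((N + 2) * b) : ℕ) : ℝ)⌋₊ := Nat.floor_mono h3
    _ = 2 * 1 * ((N + 2) * b) := Nat.floor_natCast _

end Distances

end Summit.QuantumFields.YangMills.Cruxes.IR.BlockedActivity

end
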